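import Summits.CriticalPhenomena.PercolationContinuityZ3.Theorems.Transplant.AutChartWallReduction
import Summits.CriticalPhenomena.PercolationContinuityZ3.Theorems.Transplant.CayleyLeftFramesRank
import Mathlib.GroupTheory.Index
import HarnessLib

/-!
# The WALL under a DISCRETE automorphism group: transitive subgroups have finite index, INPUT(G) is a virtual invariant, the TORSION
# no-go holds for EVERY transitive group of automorphisms, and `vb₁(Γ) ≥ 2` is NECESSARY on Cayley graphs

builds on p205010 (kernel theorem, internal audit signed; external expert review pending) — nothing in this file uses p205010; everything here is
UNCONDITIONAL (no node is assumed; nothing is claimed about the OPEN node `SamePDropOfSkeletonFrmScaled₁`).  Lane `prim-bschramm`, seat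
`prim-bschramm-p4` gen 26 (PART C3 of `P4-GENERAL.md` §48).  Helper file (`--supports stmt-CriticalPhenomena-4575 --as helper`).

WHY.  Gen 25 (`AutChart.criticalContinuity`, `Wall.conj4_autChart_of_frmScaledNode₁_of_wall`) left the residual of the one-type method in the exact
form "every TRANSITIVE group `A` of automorphisms of `G` has all its stabiliser-killing character pairs dependent" (the WALL), and the class map's row (c)
("intermediate growth, no rank-two chart") was certified only for the group of LEFT TRANSLATIONS of a torsion group (gen 24, `LeftChart.no_leftChart_of_isTorsion`).
Whether some OTHER transitive group of automorphisms of the same Cayley graph carries a chart was left open.  This file settles it whenever the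
automorphism group is DISCRETE (= a vertex stabiliser is finite — by Leemann–de la Salle every finitely generated group has such a Cayley graph, and every
finitely generated group that is not virtually abelian has one whose automorphism group is the group itself):
* §1 (`AutDiscrete.exists_stabilizer_mul`, `index_le_card`, `exists_pow_mem`): if a group `B` acts on a set with a FINITE stabiliser `K = Stab_B(t)`, every
  subgroup `A ≤ B` acting transitively satisfies `B = K·A`, hence `[B : A] ≤ |K|`, and every `b ∈ B` has a power `b^n ∈ A` with `1 ≤ n ≤ |K|`;
  relative form `[Γ : A ∩ Γ] ≤ |K|` for every subgroup `Γ`.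
* §2 (`AutDiscrete.isTorsion_of_transitive_torsion`, `char_eq_one_of_isTorsion`): a transitive TORSION subgroup and a finite stabiliser make the whole of
  `B` a torsion group, so EVERY character `A → ℤ²` of EVERY subgroup `A ≤ B` is trivial, and the wall hypothesis of gen 25 holds for every `A`
  (`wall_of_transitive_torsion`).
* §3 (`AutDiscrete.offWall_descends`, `det2_eq_zero_of_virtually`): INPUT(G) is a VIRTUAL INVARIANT — a rank-two stabiliser-killing character on one
  transitive `A ≤ B` restricts to a rank-two stabiliser-killing character on the finite-index (`≤ |K|`) subgroup `A ∩ Γ` of ANY transitive `Γ ≤ B`;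
  contrapositively, if ONE transitive `Γ` has no finite-index subgroup with such a character (torsion groups; groups all of whose finite-index subgroups
  have `b₁ ≤ 1`), then `G` is on the wall for EVERY transitive `A ≤ B`.
* §4 (graphs, `B = Aut(G)` with a finite vertex stabiliser): every chart `V → ℤ²` translated by a transitive subgroup of `Aut(G)` is CONSTANT when
  `Aut(G)` contains a transitive torsion subgroup (`AutDiscrete.chart_const_of_torsion`), so the hypotheses of gen 25's
  `AutChart.criticalContinuity_of_autSubgroup` are unsatisfiable and `G` carries NO one-type `PlanarSkeletonFrmScaled` at all
  (`no_oneType_skeleton_of_torsion`) — no growth hypothesis; the virtual form `det2_chart_eq_zero_of_virtually`.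
* §5 (Cayley graphs `Cay(Γ; S)` with a finite stabiliser in `Aut`): torsion `Γ` ⟹ no one-type scaled skeleton (`no_oneType_skeleton_cayley_of_isTorsion`);
  off the wall ⟹ `vb₁(Γ) ≥ 2` with index `≤ |Stab(1)|` (`exists_finiteIndex_rankTwo_of_offWall`) — so on such Cayley graphs the one-type method is pinned
  between `b₁(Γ) ≥ 2` (sufficient, gen 17) and `vb₁(Γ) ≥ 2` (necessary); on a GRR the framing group is `Γ_L` itself (`eq_top_of_free`).
  (The degree-`≥ 4` necessity of every skeleton interface is the separate file `PlanarSkeletonMinDegree`.)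
[cite: BenjaminiSchramm1996, Conj. 4; §2 (almost transitive graphs)] [cite: LeemannDelasalle2022, Thm. 1.1, Cor. 1.3] [cite: KozmaNitzan2024, §4 p. 16 (Lemma 8)]
-/

noncomputable section

namespace Summit.CriticalPhenomena.PercolationContinuityZ3.Theorems.Transplant

open SimpleGraph Literature.Probability.LatticeModels Literature.Probability.Percolation
open scoped Classical

namespace AutDiscrete

/-! ### §1. Transitive subgroups of a group acting with a finite stabiliser -/

section Algebra

variable {B : Type} [Group B] {V : Type} [MulAction B V] {t : V}

/-- **Frattini-type decomposition `B = Stab(t) · A`** for a subgroup `A` acting transitively: every `b` is `k * a` with `k • t = t`, `a ∈ A`. [folklore] -/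
theorem exists_stabilizer_mul (A : Subgroup B) (htr : ∀ v : V, ∃ a ∈ A, a • t = v) (b : B) :
    ∃ k ∈ MulAction.stabilizer B t, ∃ a ∈ A, b = k * a := by
  obtain ⟨a, ha, hat⟩ := htr (b⁻¹ • t)
  refine ⟨b * a, ?_, a⁻¹, A.inv_mem ha, by group⟩
  rw [MulAction.mem_stabilizer_iff, mul_smul, hat, smul_inv_smul]

/-- The stabiliser maps ONTO the coset space `B ⧸ A` of a transitive subgroup. [folklore] -/
theorem quotient_mk_stabilizer_surjective (A : Subgroup B) (htr : ∀ v : V, ∃ a ∈ A, a • t = v) :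
    Function.Surjective (fun k : MulAction.stabilizer B t => (QuotientGroup.mk (k : B) : B ⧸ A)) := by
  intro q
  obtain ⟨b, rfl⟩ := QuotientGroup.mk_surjective q
  obtain ⟨k, hk, a, ha, rfl⟩ := exists_stabilizer_mul A htr b
  refine ⟨⟨k, hk⟩, ?_⟩
  show (QuotientGroup.mk k : B ⧸ A) = QuotientGroup.mk (k * a)
  rw [QuotientGroup.eq, inv_mul_cancel_left]
  exact ha

/-- **A transitive subgroup has index at most `|Stab(t)|`** (finite stabiliser). [folklore] -/
theorem index_le_card (A : Subgroup B) (htr : ∀ v : V, ∃ a ∈ A, a • t = v) [Finite (MulAction.stabilizer B t)] :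
    A.index ≤ Nat.card (MulAction.stabilizer B t) := by
  rw [Subgroup.index_eq_card]
  exact Nat.card_le_card_of_surjective _ (quotient_mk_stabilizer_surjective A htr)

/-- **A transitive subgroup has FINITE index** (finite stabiliser): `A.index ≠ 0`. [folklore] -/
theorem index_ne_zero (A : Subgroup B) (htr : ∀ v : V, ∃ a ∈ A, a • t = v) [Finite (MulAction.stabilizer B t)] : A.index ≠ 0 := by
  haveI : Finite (B ⧸ A) := Finite.of_surjective _ (quotient_mk_stabilizer_surjective A htr)
  haveI : Nonempty (B ⧸ A) := ⟨QuotientGroup.mk 1⟩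
  rw [Subgroup.index_eq_card]
  exact Nat.card_pos.ne'

/-- **Every element has a power in a transitive subgroup**: `b ^ n ∈ A` for some `1 ≤ n ≤ |Stab(t)|`. [folklore] -/
theorem exists_pow_mem (A : Subgroup B) (htr : ∀ v : V, ∃ a ∈ A, a • t = v) [Finite (MulAction.stabilizer B t)] (b : B) :
    ∃ n : ℕ, 0 < n ∧ n ≤ Nat.card (MulAction.stabilizer B t) ∧ b ^ n ∈ A := by
  obtain ⟨n, hn, hle, hmem⟩ := A.exists_pow_mem_of_index_ne_zero (index_ne_zero A htr) b
  exact ⟨n, hn, hle.trans (index_le_card A htr), hmem⟩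

/-- Relative form: a transitive subgroup meets EVERY subgroup `Γ` in a subgroup of index `0 < [Γ : A ∩ Γ] ≤ |Stab(t)|` of `Γ`. [folklore] -/
theorem relIndex_ne_zero (A Γ : Subgroup B) (htr : ∀ v : V, ∃ a ∈ A, a • t = v) [Finite (MulAction.stabilizer B t)] : A.relIndex Γ ≠ 0 :=
  fun h => index_ne_zero A htr (by rw [← Subgroup.relIndex_top_right]; exact Subgroup.relIndex_eq_zero_of_le_right le_top h)

/-- … with `[Γ : A ∩ Γ] ≤ |Stab(t)|`. [folklore] -/
theorem relIndex_le_card (A Γ : Subgroup B) (htr : ∀ v : V, ∃ a ∈ A, a • t = v) [Finite (MulAction.stabilizer B t)] :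
    A.relIndex Γ ≤ Nat.card (MulAction.stabilizer B t) :=
  (Subgroup.relIndex_le_of_le_right (H := A) (K := Γ) le_top (by rw [Subgroup.relIndex_top_right]; exact index_ne_zero A htr)).trans
    (by rw [Subgroup.relIndex_top_right]; exact index_le_card A htr)

/-! ### §2. Torsion: a transitive torsion subgroup and a finite stabiliser make every character of every subgroup trivial -/

/-- **`B` is a torsion group** as soon as it acts with a finite stabiliser and contains a transitive torsion subgroup. [folklore] -/
theorem isTorsion_of_transitive_torsion (Γ : Subgroup B) (htr : ∀ v : V, ∃ γ ∈ Γ, γ • t = v) (htor : ∀ γ ∈ Γ, IsOfFinOrder γ)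
    [Finite (MulAction.stabilizer B t)] : Monoid.IsTorsion B := fun b => by
  obtain ⟨n, hn, -, hmem⟩ := exists_pow_mem Γ htr b
  exact (htor _ hmem).of_pow hn.ne'

end Algebra

section Torsion

variable {A : Type} [Group A]

/-- Subgroups of a torsion group are torsion groups. [folklore] -/
theorem isTorsion_subgroup {B : Type} [Group B] (hB : Monoid.IsTorsion B) (A : Subgroup B) : Monoid.IsTorsion A := by
  intro a
  obtain ⟨n, hn, h1⟩ := isOfFinOrder_iff_pow_eq_one.1 (hB (a : B))
  exact isOfFinOrder_iff_pow_eq_one.2 ⟨n, hn, Subtype.ext (by rw [Subgroup.coe_pow, h1, Subgroup.coe_one])⟩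

/-- **Every character `A → ℤ²` of a torsion group is trivial** (`a^n = 1 ⟹ n • c(a) = 0` in the torsion-free `ℤ²`). [folklore] -/
theorem char_eq_one_of_isTorsion (hA : Monoid.IsTorsion A) (c : A →* Multiplicative (Site 2)) (a : A) : c a = 1 := by
  obtain ⟨n, hn, hpow⟩ := isOfFinOrder_iff_pow_eq_one.1 (hA a)
  have h : n • Multiplicative.toAdd (c a) = 0 := by
    rw [← toAdd_pow, ← map_pow, hpow, map_one, toAdd_one]
  rw [← ofAdd_toAdd (c a), ← ofAdd_zero]
  congr 1
  funext i
  have hi : (n : ℤ) * Multiplicative.toAdd (c a) i = 0 := by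
    have := congrFun h i
    rwa [Pi.smul_apply, nsmul_eq_mul] at this
  rcases mul_eq_zero.1 hi with h0 | h0
  · exact absurd (by exact_mod_cast h0 : n = 0) hn.ne'
  · exact h0

/-- Hence no character of a torsion group has rank two. [folklore] -/
theorem det2_eq_zero_of_isTorsion (hA : Monoid.IsTorsion A) (c : A →* Multiplicative (Site 2)) (x y : A) :
    MaxArea.det2 (Multiplicative.toAdd (c x)) (Multiplicative.toAdd (c y)) = 0 := by
  rw [char_eq_one_of_isTorsion hA c x, toAdd_one, MaxArea.det2_zero_left]

end Torsion

section Wall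

variable {B : Type} [Group B] {V : Type} [MulAction B V] {t : V}

/-- **TORSION NO-GO FOR EVERY GROUP OF AUTOMORPHISMS (wall form)**: if `B` acts with a finite stabiliser and contains a transitive torsion subgroup,
then EVERY subgroup `A ≤ B` has all pairs of `ℤ`-characters dependent — the wall hypothesis of `Wall.conj4_autChart_of_frmScaledNode₁_of_wall` holds
for every `A ≤ B`, with or without the stabiliser-killing proviso (gen 24 had this for `A = Γ_L` only). [cite: BenjaminiSchramm1996, Conj. 4; §2] -/
theorem wall_of_transitive_torsion (Γ : Subgroup B) (htr : ∀ v : V, ∃ γ ∈ Γ, γ • t = v) (htor : ∀ γ ∈ Γ, IsOfFinOrder γ)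
    [Finite (MulAction.stabilizer B t)] (A : Subgroup B) (ψ₀ ψ₁ : A →* Multiplicative ℤ) (a b : A) :
    Multiplicative.toAdd (ψ₀ a) * Multiplicative.toAdd (ψ₁ b) = Multiplicative.toAdd (ψ₁ a) * Multiplicative.toAdd (ψ₀ b) :=
  LeftChart.characters_dependent_of_isTorsion (isTorsion_subgroup (isTorsion_of_transitive_torsion Γ htr htor) A) ψ₀ ψ₁ a b

/-- … and every `ℤ²`-character of every subgroup is trivial (so `AutChart.criticalContinuity` has no instance among the subgroups of `B`).
[cite: BenjaminiSchramm1996, Conj. 4; §2] -/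
theorem char_eq_one_of_transitive_torsion (Γ : Subgroup B) (htr : ∀ v : V, ∃ γ ∈ Γ, γ • t = v) (htor : ∀ γ ∈ Γ, IsOfFinOrder γ)
    [Finite (MulAction.stabilizer B t)] (A : Subgroup B) (c : A →* Multiplicative (Site 2)) (a : A) : c a = 1 :=
  char_eq_one_of_isTorsion (isTorsion_subgroup (isTorsion_of_transitive_torsion Γ htr htor) A) c a

/-! ### §3. INPUT(G) is a virtual invariant of any one transitive subgroup -/

/-- `det2 (m • u) (n • v) = m n · det2 u v`. [folklore] -/
theorem det2_nsmul_nsmul (m n : ℕ) (u v : Site 2) : MaxArea.det2 (m • u) (n • v) = (m : ℤ) * n * MaxArea.det2 u v := by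
  simp only [MaxArea.det2, Pi.smul_apply, nsmul_eq_mul]
  ring

/-- **OFF-WALL DATA DESCEND TO EVERY TRANSITIVE SUBGROUP, VIRTUALLY**: if `B` acts with a finite stabiliser `Stab(t)`, `A ≤ B` is transitive and carries
`c : A → ℤ²` of rank two killing `Stab_A(t)`, and `Γ ≤ B` is transitive, then `A ∩ Γ` has index `≤ |Stab(t)|` in `Γ` and the restriction of `c` to it
is of rank two (on powers of the rank witnesses) and kills `Stab_{A ∩ Γ}(t)`.  So "some transitive group of automorphisms is off the wall" is a property
of the COMMENSURABILITY CLASS of any one transitive group. [cite: BenjaminiSchramm1996, §2 (almost transitive graphs)] -/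
theorem offWall_descends (A Γ : Subgroup B) (htrA : ∀ v : V, ∃ a ∈ A, a • t = v) (htrΓ : ∀ v : V, ∃ γ ∈ Γ, γ • t = v)
    [Finite (MulAction.stabilizer B t)] (c : A →* Multiplicative (Site 2)) (hstab : ∀ h : A, (h : B) • t = t → c h = 1)
    (hrank : ∃ x y : A, MaxArea.det2 (Multiplicative.toAdd (c x)) (Multiplicative.toAdd (c y)) ≠ 0) :
    (A ⊓ Γ).relIndex Γ ≠ 0 ∧ (A ⊓ Γ).relIndex Γ ≤ Nat.card (MulAction.stabilizer B t) ∧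
      ∃ c' : ↥(A ⊓ Γ) →* Multiplicative (Site 2), (∀ h : ↥(A ⊓ Γ), (h : B) • t = t → c' h = 1) ∧
        ∃ x y : ↥(A ⊓ Γ), MaxArea.det2 (Multiplicative.toAdd (c' x)) (Multiplicative.toAdd (c' y)) ≠ 0 := by
  refine ⟨by rw [Subgroup.inf_relIndex_right]; exact relIndex_ne_zero A Γ htrA,
    by rw [Subgroup.inf_relIndex_right]; exact relIndex_le_card A Γ htrA, c.comp (Subgroup.inclusion inf_le_left), fun h hh => hstab _ hh, ?_⟩
  obtain ⟨x, y, hxy⟩ := hrank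
  obtain ⟨m, hm, -, hxm⟩ := exists_pow_mem Γ htrΓ (x : B)
  obtain ⟨n, hn, -, hyn⟩ := exists_pow_mem Γ htrΓ (y : B)
  refine ⟨⟨(x : B) ^ m, A.pow_mem x.2 m, hxm⟩, ⟨(y : B) ^ n, A.pow_mem y.2 n, hyn⟩, ?_⟩
  have ex : (c.comp (Subgroup.inclusion inf_le_left)) ⟨(x : B) ^ m, A.pow_mem x.2 m, hxm⟩ = c (x ^ m) :=
    congrArg c (Subtype.ext (by simp))
  have ey : (c.comp (Subgroup.inclusion inf_le_left)) ⟨(y : B) ^ n, A.pow_mem y.2 n, hyn⟩ = c (y ^ n) :=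
    congrArg c (Subtype.ext (by simp))
  rw [ex, ey, map_pow c x m, map_pow c y n, toAdd_pow, toAdd_pow, det2_nsmul_nsmul]
  exact mul_ne_zero (mul_ne_zero (by exact_mod_cast hm.ne') (by exact_mod_cast hn.ne')) hxy

/-- **THE VIRTUAL CRITERION FOR THE WALL**: if `B` acts with a finite stabiliser and ONE transitive subgroup `Γ ≤ B` has NO finite-index subgroup carrying
a rank-two `ℤ²`-character killing its stabiliser (e.g. `Γ` torsion; `Γ` acting freely with all finite-index subgroups of first Betti number `≤ 1`), then
EVERY transitive `A ≤ B` is on the wall: every `c : A → ℤ²` killing `Stab_A(t)` has rank `≤ 1`. [cite: BenjaminiSchramm1996, Conj. 4; §2] -/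
theorem det2_eq_zero_of_virtually (Γ : Subgroup B) (htrΓ : ∀ v : V, ∃ γ ∈ Γ, γ • t = v) [Finite (MulAction.stabilizer B t)]
    (hΓ : ∀ Γ₀ : Subgroup B, Γ₀ ≤ Γ → Γ₀.relIndex Γ ≠ 0 → ∀ c : Γ₀ →* Multiplicative (Site 2),
      (∀ h : Γ₀, (h : B) • t = t → c h = 1) → ∀ x y : Γ₀, MaxArea.det2 (Multiplicative.toAdd (c x)) (Multiplicative.toAdd (c y)) = 0)
    (A : Subgroup B) (htrA : ∀ v : V, ∃ a ∈ A, a • t = v) (c : A →* Multiplicative (Site 2)) (hstab : ∀ h : A, (h : B) • t = t → c h = 1)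
    (x y : A) : MaxArea.det2 (Multiplicative.toAdd (c x)) (Multiplicative.toAdd (c y)) = 0 := by
  by_contra hne
  obtain ⟨h0, -, c', hc', x', y', hne'⟩ := offWall_descends A Γ htrA htrΓ c hstab ⟨x, y, hne⟩
  exact hne' (hΓ (A ⊓ Γ) inf_le_right h0 c' hc' x' y')

end Wall

/-! ### §4. Graphs with a DISCRETE automorphism group (a finite vertex stabiliser in `Aut(G)`) -/

section Graph

variable {V : Type} {G : SimpleGraph V}

/-- **`Aut(G)` is a torsion group** when some vertex stabiliser in `Aut(G)` is finite and some transitive subgroup is torsion (e.g. the left translations of a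
torsion group on a Cayley graph with discrete automorphism group — every finitely generated group has such a Cayley graph, Leemann–de la Salle Cor. 1.3).
[cite: LeemannDelasalle2022, Thm. 1.1, Cor. 1.3] -/
theorem aut_isOfFinOrder_of_torsion (t : V) (hfin : {α : G ≃g G | α t = t}.Finite) (Γ : Subgroup (G ≃g G))
    (htr : ∀ v : V, ∃ γ ∈ Γ, γ t = v) (htor : ∀ γ ∈ Γ, IsOfFinOrder γ) (α : G ≃g G) : IsOfFinOrder α := by
  letI : MulAction (G ≃g G) V := AutChart.autMulAction G
  haveI : Finite (MulAction.stabilizer (G ≃g G) t) := by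
    have e : (MulAction.stabilizer (G ≃g G) t : Set (G ≃g G)) = {α : G ≃g G | α t = t} := by
      ext α; exact MulAction.mem_stabilizer_iff
    exact (e ▸ hfin).to_subtype
  exact isTorsion_of_transitive_torsion (t := t) Γ htr htor α

/-- **EVERY CHART TRANSLATED BY A TRANSITIVE GROUP OF AUTOMORPHISMS IS CONSTANT** on such a graph: for `A ≤ Aut(G)` transitive and `φ : V → ℤ²` with
`φ(α w) − φ w` independent of `w` for `α ∈ A`, `φ x = φ t` for all `x` — the translation character of `A` is a character of a torsion group.  So the
hypotheses of `AutChart.criticalContinuity_of_autSubgroup` are UNSATISFIABLE on `G` for every `A`: the one-type method is void there, for every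
transitive group of automorphisms (gen 24 `LeftChart.no_leftChart_of_isTorsion`: `A = Γ_L` only). [cite: BenjaminiSchramm1996, Conj. 4; §2]
[cite: LeemannDelasalle2022, Thm. 1.1, Cor. 1.3] -/
theorem chart_const_of_torsion (t : V) (hfin : {α : G ≃g G | α t = t}.Finite) (Γ : Subgroup (G ≃g G))
    (htrΓ : ∀ v : V, ∃ γ ∈ Γ, γ t = v) (htor : ∀ γ ∈ Γ, IsOfFinOrder γ) (A : Subgroup (G ≃g G)) (htrA : ∀ v : V, ∃ α ∈ A, α t = v)
    (φ : V → Site 2) (hφ : ∀ α ∈ A, ∀ w : V, φ (α w) = φ w + (φ (α t) - φ t)) (x : V) : φ x = φ t := by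
  letI : MulAction (G ≃g G) V := AutChart.autMulAction G
  have hA : Monoid.IsTorsion A := isTorsion_subgroup (fun α => aut_isOfFinOrder_of_torsion t hfin Γ htrΓ htor α) A
  obtain ⟨α, hα, rfl⟩ := htrA x
  have h := char_eq_one_of_isTorsion hA (AutChart.chartHom t φ (fun (a : A) w => hφ a a.2 w)) ⟨α, hα⟩
  have h' := congrArg Multiplicative.toAdd h
  rw [AutChart.toAdd_chartHom, toAdd_one] at h'
  exact (sub_eq_zero.1 h').trans rfl

/-- **NO ONE-TYPE SCALED SKELETON** (the interface of the open node `U_s`) exists on a locally finite graph whose automorphism group has a finite vertex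
stabiliser and a transitive torsion subgroup — NO growth hypothesis, EVERY framing group (compare `AutChart.exists_oneType_skeleton_iff`, which needs
subexponential growth, and gen 24's `LeftChart.no_leftFrames_frmScaled_of_isTorsion`, which excludes `Γ_L`-frames only).  Customers (R-level): every
Cayley graph with discrete automorphism group of every finitely generated torsion group — Grigorchuk's and Gupta–Sidki's groups of intermediate growth have
such Cayley graphs by Leemann–de la Salle. [cite: LeemannDelasalle2022, Thm. 1.1, Cor. 1.3] [cite: BenjaminiSchramm1996, Conj. 4] -/
theorem no_oneType_skeleton_of_torsion [G.LocallyFinite] (t : V) (hfin : {α : G ≃g G | α t = t}.Finite) (Γ : Subgroup (G ≃g G))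
    (htrΓ : ∀ v : V, ∃ γ ∈ Γ, γ t = v) (htor : ∀ γ ∈ Γ, IsOfFinOrder γ) (Φ : PlanarSkeletonFrmScaled G) (s : V) : Φ.types ≠ {s} := by
  intro hs
  obtain ⟨A, hA, htrA, -⟩ := FrmScaledAut.translating_transitive_rankTwo Φ hs
  -- move the finite stabiliser and the torsion transitive subgroup to the base vertex `s`
  obtain ⟨γ, hγ, hγs⟩ := htrΓ s
  have hfin_s : {α : G ≃g G | α s = s}.Finite := by
    have hsub : {α : G ≃g G | α s = s} ⊆ (fun β => γ * β * γ⁻¹) '' {α : G ≃g G | α t = t} := by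
      intro α hα
      refine ⟨γ⁻¹ * α * γ, ?_, by group⟩
      show (γ⁻¹ * α * γ) t = t
      have hα' : α s = s := hα
      rw [← hγs] at hα'
      show γ.symm (α (γ t)) = t
      rw [hα', RelIso.symm_apply_apply]
    exact (hfin.image _).subset hsub
  have htrΓs : ∀ v : V, ∃ γ' ∈ Γ, γ' s = v := by
    intro v
    obtain ⟨δ, hδ, hδv⟩ := htrΓ v
    refine ⟨δ * γ⁻¹, Γ.mul_mem hδ (Γ.inv_mem hγ), ?_⟩
    show δ (γ.symm s) = v
    rw [← hγs, RelIso.symm_apply_apply, hδv]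
  have hconst := chart_const_of_torsion s hfin_s Γ htrΓs htor A htrA Φ.φ hA
  obtain ⟨x, -, hx⟩ := Φ.step s 0 1
  have h0 : (Pi.single (0 : Fin 2) ((Φ.N : ℤ) * ((1 : ℤˣ) : ℤ)) : Site 2) = 0 := by
    have := hconst x
    rw [hx] at this
    exact add_left_cancel (a := Φ.φ s) (this.trans (add_zero _).symm)
  have := congrFun h0 0
  rw [Pi.single_eq_same, Units.val_one, mul_one, Pi.zero_apply] at this
  have := Φ.one_le_N; omega

/-- **THE VIRTUAL CRITERION ON GRAPHS**: `Aut(G)` with a finite vertex stabiliser, ONE transitive subgroup `Γ ≤ Aut(G)` none of whose finite-index subgroups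
carries a rank-two `ℤ²`-character killing its stabiliser of `t` ⟹ for EVERY transitive `A ≤ Aut(G)` and every chart `φ` translated by `A`:
`det(φ x − φ t, φ y − φ t) = 0` — the rank hypothesis of `AutChart.criticalContinuity_of_autSubgroup` fails for every `A`. [cite: BenjaminiSchramm1996, Conj. 4; §2] -/
theorem det2_chart_eq_zero_of_virtually (t : V) (hfin : {α : G ≃g G | α t = t}.Finite) (Γ : Subgroup (G ≃g G))
    (htrΓ : ∀ v : V, ∃ γ ∈ Γ, γ t = v)
    (hΓ : ∀ Γ₀ : Subgroup (G ≃g G), Γ₀ ≤ Γ → Γ₀.relIndex Γ ≠ 0 → ∀ c : Γ₀ →* Multiplicative (Site 2),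
      (∀ h : Γ₀, (h : G ≃g G) t = t → c h = 1) → ∀ x y : Γ₀, MaxArea.det2 (Multiplicative.toAdd (c x)) (Multiplicative.toAdd (c y)) = 0)
    (A : Subgroup (G ≃g G)) (htrA : ∀ v : V, ∃ α ∈ A, α t = v) (φ : V → Site 2) (hφ : ∀ α ∈ A, ∀ w : V, φ (α w) = φ w + (φ (α t) - φ t))
    (x y : V) : MaxArea.det2 (φ x - φ t) (φ y - φ t) = 0 := by
  letI : MulAction (G ≃g G) V := AutChart.autMulAction G
  haveI : Finite (MulAction.stabilizer (G ≃g G) t) := by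
    have e : (MulAction.stabilizer (G ≃g G) t : Set (G ≃g G)) = {α : G ≃g G | α t = t} := by
      ext α; exact MulAction.mem_stabilizer_iff
    exact (e ▸ hfin).to_subtype
  obtain ⟨α, hα, rfl⟩ := htrA x
  obtain ⟨β, hβ, rfl⟩ := htrA y
  have h := det2_eq_zero_of_virtually (t := t) Γ htrΓ hΓ A htrA (AutChart.chartHom t φ (fun (a : A) w => hφ a a.2 w))
    (fun h hh => by
      show Multiplicative.ofAdd (φ ((h : G ≃g G) t) - φ t) = 1
      rw [show (h : G ≃g G) t = t from hh, sub_self, ofAdd_zero]) ⟨α, hα⟩ ⟨β, hβ⟩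
  rwa [AutChart.toAdd_chartHom, AutChart.toAdd_chartHom] at h

/-- … and then NO one-type scaled skeleton is BASED AT `t` (for a skeleton based elsewhere apply the theorem at its base vertex: the finite stabiliser
travels by conjugation, the hypothesis on `Γ` is to be supplied there). [cite: BenjaminiSchramm1996, Conj. 4] [cite: KozmaNitzan2024, §4 p. 16 (Lemma 8)] -/
theorem no_oneType_skeleton_at_of_virtually [G.LocallyFinite] (t : V) (hfin : {α : G ≃g G | α t = t}.Finite) (Γ : Subgroup (G ≃g G))
    (htrΓ : ∀ v : V, ∃ γ ∈ Γ, γ t = v) (hΓ : ∀ Γ₀ : Subgroup (G ≃g G), Γ₀ ≤ Γ → Γ₀.relIndex Γ ≠ 0 → ∀ c : Γ₀ →* Multiplicative (Site 2),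
      (∀ h : Γ₀, (h : G ≃g G) t = t → c h = 1) → ∀ x y : Γ₀, MaxArea.det2 (Multiplicative.toAdd (c x)) (Multiplicative.toAdd (c y)) = 0)
    (Φ : PlanarSkeletonFrmScaled G) : Φ.types ≠ {t} := by
  intro ht
  obtain ⟨A, hA, htrA, -⟩ := FrmScaledAut.translating_transitive_rankTwo Φ ht
  obtain ⟨x, -, hx⟩ := Φ.step t 0 1
  obtain ⟨y, -, hy⟩ := Φ.step t 1 1
  have h := det2_chart_eq_zero_of_virtually t hfin Γ htrΓ hΓ A htrA Φ.φ hA x y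
  rw [hx, hy, Units.val_one, mul_one, add_sub_cancel_left, add_sub_cancel_left, MaxArea.det2] at h
  have := Φ.one_le_N
  simp at h; omega

end Graph

/-! ### §5. Cayley graphs `Cay(Γ; S) = mulCayley ↑S` with a DISCRETE automorphism group -/

section CayleyGraph

variable {Γ : Type} [Group Γ] (S : Finset Γ)

/-- **CAYLEY GRAPHS OF TORSION GROUPS WITH DISCRETE AUTOMORPHISM GROUP: no one-type scaled skeleton, whatever the framing group** — `Γ` torsion,
`S` finite, the stabiliser of `1` in `Aut(Cay(Γ; S))` finite ⟹ `Cay(Γ; S)` carries NO one-type `PlanarSkeletonFrmScaled` (and every chart translated by a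
transitive group of automorphisms is constant, `chart_const_of_torsion`).  By Leemann–de la Salle every finitely generated group has such an `S`
(Cor. 1.3), every non-virtually-abelian one an `S` with `Aut = Γ_L` (Thm. 1.1): the torsion groups of intermediate growth lie outside the one-type
method on these Cayley graphs for EVERY group of automorphisms. [cite: LeemannDelasalle2022, Thm. 1.1, Cor. 1.3] [cite: BenjaminiSchramm1996, Conj. 4; §2] -/
theorem no_oneType_skeleton_cayley_of_isTorsion (hΓ : Monoid.IsTorsion Γ) [(mulCayley (S : Set Γ)).LocallyFinite]
    (hfin : {α : mulCayley (S : Set Γ) ≃g mulCayley (S : Set Γ) | α 1 = 1}.Finite) (Φ : PlanarSkeletonFrmScaled (mulCayley (S : Set Γ)))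
    (s : Γ) : Φ.types ≠ {s} := by
  let L : Γ →* (mulCayley (S : Set Γ) ≃g mulCayley (S : Set Γ)) :=
    { toFun := leftMulIso S, map_one' := RelIso.ext fun w => one_mul w, map_mul' := fun g h => RelIso.ext fun w => mul_assoc g h w }
  exact no_oneType_skeleton_of_torsion 1 hfin L.range (fun v => ⟨leftMulIso S v, ⟨v, rfl⟩, mul_one v⟩)
    (by rintro γ ⟨g, rfl⟩; exact L.isOfFinOrder (hΓ g)) Φ s

/-- **`vb₁(Γ) ≥ 2` IS NECESSARY (discrete automorphism group)**: if SOME transitive `A ≤ Aut(Cay(Γ; S))` carries `c : A → ℤ²` of rank two killing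
`Stab_A(1)` — the input of `AutChart.criticalContinuity` — and the stabiliser of `1` in `Aut(Cay(Γ; S))` is finite, then `Γ` has a subgroup `Γ₀` of
finite index `≤ |Stab(1)|` with a homomorphism `Γ₀ → ℤ²` of rank-two image.  With gen 17's sufficiency of `b₁(Γ) ≥ 2` (`CayleyScaled.criticalContinuity_of_rank`)
the range of the one-type method on such Cayley graphs is pinned between `b₁(Γ) ≥ 2` (sufficient) and `vb₁(Γ) ≥ 2` (necessary): the gap is exactly the wall.
[cite: BenjaminiSchramm1996, Conj. 4; §2 (Cayley graphs)] [cite: LeemannDelasalle2022, Cor. 1.3] -/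
theorem exists_finiteIndex_rankTwo_of_offWall (hfin : {α : mulCayley (S : Set Γ) ≃g mulCayley (S : Set Γ) | α 1 = 1}.Finite)
    (A : Subgroup (mulCayley (S : Set Γ) ≃g mulCayley (S : Set Γ))) (htrA : ∀ v : Γ, ∃ α ∈ A, α 1 = v)
    (c : A →* Multiplicative (Site 2)) (hstab : ∀ h : A, (h : mulCayley (S : Set Γ) ≃g mulCayley (S : Set Γ)) 1 = 1 → c h = 1)
    (hrank : ∃ x y : A, MaxArea.det2 (Multiplicative.toAdd (c x)) (Multiplicative.toAdd (c y)) ≠ 0) :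
    ∃ Γ₀ : Subgroup Γ, Γ₀.index ≠ 0 ∧ Γ₀.index ≤ {α : mulCayley (S : Set Γ) ≃g mulCayley (S : Set Γ) | α 1 = 1}.ncard ∧
      ∃ c₀ : Γ₀ →* Multiplicative (Site 2), ∃ x y : Γ₀, MaxArea.det2 (Multiplicative.toAdd (c₀ x)) (Multiplicative.toAdd (c₀ y)) ≠ 0 := by
  letI : MulAction (mulCayley (S : Set Γ) ≃g mulCayley (S : Set Γ)) Γ := AutChart.autMulAction (mulCayley (S : Set Γ))
  have e : (MulAction.stabilizer (mulCayley (S : Set Γ) ≃g mulCayley (S : Set Γ)) (1 : Γ) : Set (mulCayley (S : Set Γ) ≃g mulCayley (S : Set Γ))) =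
      {α : mulCayley (S : Set Γ) ≃g mulCayley (S : Set Γ) | α 1 = 1} := by
    ext α; exact MulAction.mem_stabilizer_iff
  haveI : Finite (MulAction.stabilizer (mulCayley (S : Set Γ) ≃g mulCayley (S : Set Γ)) (1 : Γ)) := (e ▸ hfin).to_subtype
  have hcard : Nat.card (MulAction.stabilizer (mulCayley (S : Set Γ) ≃g mulCayley (S : Set Γ)) (1 : Γ)) =
      {α : mulCayley (S : Set Γ) ≃g mulCayley (S : Set Γ) | α 1 = 1}.ncard := by
    rw [← Nat.card_coe_set_eq]
    exact Nat.card_congr (Equiv.subtypeEquivRight fun α => (MulAction.mem_stabilizer_iff :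
      α ∈ MulAction.stabilizer (mulCayley (S : Set Γ) ≃g mulCayley (S : Set Γ)) (1 : Γ) ↔ _))
  let L : Γ →* (mulCayley (S : Set Γ) ≃g mulCayley (S : Set Γ)) :=
    { toFun := leftMulIso S, map_one' := RelIso.ext fun w => one_mul w, map_mul' := fun g h => RelIso.ext fun w => mul_assoc g h w }
  obtain ⟨h0, hle, c', -, x', y', hne⟩ :=
    offWall_descends (t := (1 : Γ)) A L.range htrA (fun v => ⟨leftMulIso S v, ⟨v, rfl⟩, mul_one v⟩) c hstab hrank
  refine ⟨(A ⊓ L.range).comap L, ?_, ?_, c'.comp ((L.restrict _).codRestrict (A ⊓ L.range) fun g => g.2), ?_⟩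
  · rwa [Subgroup.index_comap]
  · rw [Subgroup.index_comap, ← hcard]; exact hle
  · obtain ⟨gx, hgx⟩ : (x' : mulCayley (S : Set Γ) ≃g mulCayley (S : Set Γ)) ∈ L.range := x'.2.2
    obtain ⟨gy, hgy⟩ : (y' : mulCayley (S : Set Γ) ≃g mulCayley (S : Set Γ)) ∈ L.range := y'.2.2
    have hgx' : gx ∈ (A ⊓ L.range).comap L := by rw [Subgroup.mem_comap, hgx]; exact x'.2
    have hgy' : gy ∈ (A ⊓ L.range).comap L := by rw [Subgroup.mem_comap, hgy]; exact y'.2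
    refine ⟨⟨gx, hgx'⟩, ⟨gy, hgy'⟩, ?_⟩
    have ex : (c'.comp ((L.restrict _).codRestrict (A ⊓ L.range) fun g => g.2)) ⟨gx, hgx'⟩ = c' x' :=
      congrArg c' (Subtype.ext hgx)
    have ey : (c'.comp ((L.restrict _).codRestrict (A ⊓ L.range) fun g => g.2)) ⟨gy, hgy'⟩ = c' y' :=
      congrArg c' (Subtype.ext hgy)
    rwa [ex, ey]

/-- **On a GRAPHICAL REGULAR REPRESENTATION the framing group is forced**: if a group `B` acts FREELY and some subgroup `A ≤ B` acts transitively,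
then `A = B` — so on a Cayley graph with `Aut(Cay(Γ; S)) = Γ_L` (a GRR; every finitely generated group that is neither abelian nor generalised dicyclic has
one, Leemann–de la Salle Cor. 1.2) the only transitive group of automorphisms is `Γ_L` itself and INPUT(G) ⟺ `b₁(Γ) ≥ 2`. [cite: LeemannDelasalle2022, Cor. 1.2] -/
theorem eq_top_of_free {B : Type} [Group B] {V : Type} [MulAction B V] {t : V} (hfree : ∀ b : B, b • t = t → b = 1) (A : Subgroup B)
    (htr : ∀ v : V, ∃ a ∈ A, a • t = v) : A = ⊤ := by
  refine (Subgroup.eq_top_iff' A).2 fun b => ?_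
  obtain ⟨k, hk, a, ha, rfl⟩ := exists_stabilizer_mul A htr b
  rw [hfree k hk, one_mul]
  exact ha

end CayleyGraph

end AutDiscrete

end Summit.CriticalPhenomena.PercolationContinuityZ3.Theorems.Transplant

end
-- build-touch 2026-08-25T18:45Z T1-D (lead g19 #4316 (5)): re-land of p402220, declarations byte-identical
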